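import Literature.NumberTheory.Automorphic.Liu2021.LemD1AsPrintedIndexedNonVacuityTameTwist
import Literature.NumberTheory.Automorphic.AdicCompletionCompact
import Mathlib.Topology.Algebra.OpenSubgroup
import HarnessLib

/-!
# [Liu2021, App. D §D.1 Step 2 ∕ Lemma D.1 (3)] — the LEVEL TWIST: next to every Step-2 datum of the place model there is a
# DIFFERENT one at EVERY finite place, the places above `2` included; the μ-teeth of (3) AS PRINTED bite everywhere

Reproduction ∕ bookkeeping (Literature, THEOREMS ONLY: no definition, no record, no named fact, no `sorry`; nothing is
asserted about Liu's oscillator representations or about the tree's constructed local Weil carriers).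

Sequel of `LemD1AsPrintedIndexedNonVacuityTameTwist.lean`, whose «What this does NOT give» names «places above `2` (there
`−1 ∈ 1 + 𝔭_w` and a wild character would be needed)»: every statement of that file carried the hypothesis `2 ∉ w` (resp. `2 ∉ v`)
because its character `θ_w` was TAME (trivial on the principal units `U_w^{(1)} = 1 + 𝔭_w`, read off the residue field `κ(w)`), and at a
place above `2` the element `−1` IS a principal unit.  THIS FILE removes the hypothesis: the character is taken of LEVEL `e + 1`,
`e = ord_w(2)`, i.e. trivial on the higher unit group `U_w^{(e+1)} = 1 + 2𝔭_w = {x : v_w(x − 1) < v_w(2)}` ([NeukirchANT1999, Ch. II §3]: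
«`U^{(n)} = 1 + 𝔭^n = {x ∈ K^* ∣ |1 − x| < q^{−(n−1)}}` … the n-th higher unit group»; Prop. (3.10): `𝒪^*/U^{(n)} ≅ (𝒪/𝔭^n)^*`, a
finite group), which does NOT contain `−1` (`v_w(−1 − 1) = v_w(2)`).  In the kernel the finite quotient `𝒪_wˣ / U_w^{(e+1)}` is obtained
topologically: `𝒪_w` is compact (tree `compactSpace_adicCompletionIntegers'`), hence so is `𝒪_wˣ` (Mathlib), and `U_w^{(e+1)}` is an open
subgroup, so the quotient is finite (Mathlib `Subgroup.quotient_finite_of_isOpen`); a character of this finite abelian group not killing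
the class of `−1` exists (Mathlib `CommGroup.exists_apply_ne_one_of_hasEnoughRootsOfUnity`), and is pulled back along the unit-part map
`E_wˣ → 𝒪_wˣ`, `x ↦ x · ϖ_w^{ord x}` ([NeukirchANT1999, Ch. II §5 Prop. (5.3)], `K^* = (π) × 𝒪^*`-part).  At `w ∤ 2` (`e = 0`) this is a
tame character again; at `w ∣ 2` it is necessarily WILD (non-trivial on `U^{(1)} ∋ −1`).

Setting (as in the prequel): the tree's place model of a quadratic extension `E/F` of number fields at a finite place `v`
(`F_v = v.adicCompletion F`, `E_v = UnitaryGroup.LocalRing E v = Π_{w∣v} E_w`, `c ⊗ 1 = conjLocal`, Step 1's representative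
`ε = δ ⊗ 1 = LemD1OfPlace.eps`, `c δ = −δ ≠ 0`), a place `w ∣ v` — NO hypothesis on `w` —; a «Step-2 datum» is the rows' displayed
binder shape: `μ : E_vˣ → ℂˣ` unitary, continuous, with the printed clause «`μ(ι_v a) = 1 ↔ a ∈ Nm E_vˣ`» ([Liu2021, App. D §D.1
Step 2, l. 5219]); its packaged form is `LemD1OfPlace.muOf … ∈ LemD1.MuSet S`.

* §1 (any number field `E`, ANY finite place `w`) **`exists_level_character`**: a character `θ_w : E_wˣ → ℂˣ` of FINITE ORDER with OPEN
  KERNEL, unitary, trivial on `U_w^{(e+1)} = {x : v_w(x − 1) < v_w(2)}`, and `θ_w(−1) ≠ 1`.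
* §2 (place model, any `w ∣ v`) **`exists_twistChar`**: `χ(x) := θ_w((x · ((c ⊗ 1) x)⁻¹)_w)` — unitary, continuous, of finite order,
  TRIVIAL on every `(c ⊗ 1)`-fixed unit (so on `ι_v(F_vˣ)`), `χ(ε) = θ_w(−1) = −1`.
* §3 **`exists_stepTwo_twist`**: next to EVERY Step-2 datum `μ` the Step-2 datum `μ' = μ · χ` with `μ'(ε) = −μ(ε)`, `μ' ≠ μ`, equal to
  `μ` on the `(c ⊗ 1)`-fixed units; `MuSet` ∕ `muOf` forms `exists_muSet_ne_twist`, `exists_muOf_ne_twist`; **`exists_muSet_ne_of_nonempty`**: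
  at NO finite place is a Step-2 datum unique (the printed index set is empty or has two elements).
* §4 (rank `N ≥ 3`) **`exists_lemD1IndexedFamily_item1_not_lemD1_3_twist`** + **`not_forall_lemD1_3_of_item1_twist`**: at EVERY place
  carrying a Step-2 datum the two-member trivial-carrier collection `(μ, e, 1)`, `(μ', e, 1)` satisfies [Lem. D.1, first sentence + (1)]
  AS PRINTED member by member and VIOLATES `LemD1_3AsPrintedI` — (3) AS PRINTED is not a consequence of (1) anywhere.
* §5 (the CM rows: `L` CM, `F = L⁺`, `c` = complex conjugation, `δ = imagUnit L`, the rows' own `μ_v = localMu L (toHeckeCharacter L ψ) v`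
  for a conjugate symplectic `ψ`, [Liu2021, Def. 4.1 ∕ 4.11]) — at EVERY place `v` of `L⁺`: **`exists_muOf_ne_localMu_twist`** (a
  companion `μ'` of the rows' own label, `μ'(ε) = −μ_v(ε)`, `muOf μ' ≠ muOf μ_v` with VERBATIM the rows' displayed proofs),
  **`exists_muSet_ne_of_isCMField`** ∕ `forall_exists_muSet_ne_of_isCMField` (the printed Step-2 index set of the rows' standing data has
  two elements at EVERY `v` — the prequel's cofinite `eventually_exists_muSet_ne` with its exceptional set removed),
  **`exists_lemD1IndexedFamily_item1_not_lemD1_3_localMu_twist`** ∕ `forall_not_forall_lemD1_3_of_item1_of_isCMField` (the μ-teeth of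
  (3) with the rows' own `μ_v` as one label, at every `v`).

What this does NOT give: that the companion `μ'` is ITSELF a rows' label `localMu L (toHeckeCharacter L ψ') v` for another conjugate
symplectic `ψ'` of the same ∞-type (globalisation of `θ_w` by [ClozelHarrisTaylor2008, Lem. 4.1.1] — the sequel, as `…TameTwistCM` was
for the tame twist); a Step-2 datum at a non-split place ABOVE `2` of a GENERAL (non-CM) `E/F` to start from (the local norm index at a
dyadic place; `…NormClassExtension` ∕ `…InertSign` stop at `∤ 2`); the joint (1) ∧ (3) certificate with the level carrier `θ_w ∘ det_w`
(as `…TameCarrier`, `N` odd); the explicit level (conductor) of `θ_w`; anything about the rows' carriers `𝓢.omegaLoc v` or `χ_v`; Lem.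
D.1 itself.  HC_CM is NOT proved.

Cell pub-hodgecm2 (COR-CM), audit class of the END rows `hD1''` ∕ `hD3`; seat prover-pub-hodgecm2-b10.

References: [Liu2021] Y. Liu, *Fourier–Jacobi cycles and arithmetic relative trace formula*, Camb. J. Math. 9 (2021) =
arXiv:2102.11518, App. D §D.1 Steps 1–2 (`FJcycle.tex` l. 5217–5219), Lemma D.1 (1) (l. 5229), (3) (l. 5233), Def. 4.1
(l. 1900–1902), Def. 4.11 (l. 2086); [NeukirchANT1999] J. Neukirch, *Algebraic Number Theory* (1999), Ch. II §3 (the higher unit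
groups `U^{(n)}`) with Prop. (3.10) (`𝒪^*/U^{(n)} ≅ (𝒪/𝔭^n)^*`), Ch. II §5 Prop. (5.3) (`K^* = (π) × μ_{q−1} × U^{(1)}`);
[CasselsFrohlichANT1967] Ch. II §10 (`L ⊗_K K_v = Π_{w∣v} L_w`); [WeilBNT1967] A. Weil, *Basic Number Theory*, Ch. I §4 (the maximal
compact subring of a p-field).
-/

noncomputable section

open scoped Matrix MatrixGroups
open NumberField IsDedekindDomain
open Literature.RepresentationTheory
open Literature.RepresentationTheory.CentralCharacterQuotient (augmentation quotRep quotRep_mk)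
open Literature.NumberTheory.GaloisRepresentations (HeckeCharacter)

namespace Literature.NumberTheory.Automorphic.Liu2021.LemD1IndexedNonVacuityLevelTwist

/-! ## §1 A LEVEL character of `E_wˣ` at ANY place `w`: finite order, open kernel, trivial on `1 + 2𝔭_w`, `θ_w(−1) ≠ 1` -/

section Local

variable {E : Type} [Field E] [NumberField E] (w : HeightOneSpectrum (𝓞 E))

/-- **the unit-part homomorphism `E_wˣ → 𝒪_wˣ`, `x ↦ x · ϖ_w^{ord_w x}`**, the identity on `𝒪_wˣ` (copy of the private lemma of
`LemD1IndexedNonVacuityTameTwist`). [cite: NeukirchANT1999, Ch. II §5 Prop. (5.3)] -/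
private theorem exists_unitPart :
    ∃ υ : (w.adicCompletion E)ˣ →* (w.adicCompletionIntegers E).unitGroup,
      ∀ x : (w.adicCompletion E)ˣ, Valued.v (x : w.adicCompletion E) = 1 →
        ((υ x : (w.adicCompletionIntegers E).unitGroup) : (w.adicCompletion E)ˣ) = x := by
  set ϖ : (w.adicCompletion E)ˣ := HeckeCharacter.uniformizer E w with hϖdef
  have hϖ : Valued.v (ϖ : w.adicCompletion E) = WithZero.exp (-1 : ℤ) := HeckeCharacter.valued_uniformizer w
  have hne : ∀ x : (w.adicCompletion E)ˣ, Valued.v (x : w.adicCompletion E) ≠ 0 := fun x =>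
    (Valuation.ne_zero_iff _).2 x.ne_zero
  let f : (w.adicCompletion E)ˣ →* (w.adicCompletion E)ˣ :=
    { toFun := fun x => x * ϖ ^ WithZero.log (Valued.v (x : w.adicCompletion E))
      map_one' := by rw [Units.val_one, map_one, WithZero.log_one, zpow_zero, one_mul]
      map_mul' := fun x y => by
        rw [Units.val_mul, map_mul, WithZero.log_mul (hne x) (hne y), zpow_add, mul_mul_mul_comm] }
  have hf : ∀ x, Valued.v ((f x : (w.adicCompletion E)ˣ) : w.adicCompletion E) = 1 := by
    intro x
    change Valued.v (((x * ϖ ^ WithZero.log (Valued.v (x : w.adicCompletion E)) : (w.adicCompletion E)ˣ)) :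
      w.adicCompletion E) = 1
    obtain ⟨m, hm⟩ : ∃ m : ℤ, Valued.v (x : w.adicCompletion E) = WithZero.exp m :=
      ⟨_, (WithZero.exp_log (hne x)).symm⟩
    rw [Units.val_mul, Units.val_zpow_eq_zpow_val, map_mul, map_zpow₀, hϖ, ← WithZero.exp_zsmul, smul_eq_mul,
      mul_neg, mul_one, hm, WithZero.log_exp, ← WithZero.exp_add, add_neg_cancel, WithZero.exp_zero]
  refine ⟨MonoidHom.codRestrict f _ fun x => (Valuation.mem_unitGroup_iff _ Valued.v (f x)).2 (hf x), fun x hx => ?_⟩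
  rw [MonoidHom.codRestrict_apply]
  change x * ϖ ^ WithZero.log (Valued.v (x : w.adicCompletion E)) = x
  rw [hx, WithZero.log_one, zpow_zero, mul_one]

/-- `v_w(2) ≠ 0` and `v_w(2) ≤ 1` in `E_w` (characteristic `0`; `2 = 1 + 1`). [folklore] -/
private theorem valued_two_ne_zero_and_le_one :
    Valued.v (2 : w.adicCompletion E) ≠ 0 ∧ Valued.v (2 : w.adicCompletion E) ≤ 1 := by
  refine ⟨(Valuation.ne_zero_iff _).2 ?_, ?_⟩
  · have : (2 : w.adicCompletion E) = algebraMap E (w.adicCompletion E) 2 := by rw [map_ofNat]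
    rw [this]
    exact (map_ne_zero_iff _ (algebraMap E (w.adicCompletion E)).injective).2 two_ne_zero
  · rw [show (2 : w.adicCompletion E) = 1 + 1 by norm_num]
    exact (Valuation.map_add _ _ _).trans (by rw [Valuation.map_one, max_self])

/-- the «level set» `{y : v_w(y − 1) < v_w(2)} = 1 + 2𝔭_w` is open in `E_w`. [cite: NeukirchANT1999, Ch. II §3, before Prop. (3.10)] -/
private theorem isOpen_setOf_valued_sub_one_lt_two :
    IsOpen {y : w.adicCompletion E | Valued.v (y - 1) < Valued.v (2 : w.adicCompletion E)} := by
  have h := (Valued.isOpen_ball (w.adicCompletion E) (Valued.v.restrict (2 : w.adicCompletion E))).preimage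
    (show Continuous fun y : w.adicCompletion E => y - 1 from continuous_id.sub continuous_const)
  convert h using 1
  ext y
  simp only [Set.mem_setOf_eq, Set.mem_preimage, Valuation.restrict_lt_iff]

/-- **a LEVEL character of `E_wˣ` at ANY finite place `w`** (the places above `2` included): a homomorphism `θ_w : E_wˣ → ℂˣ` with
OPEN KERNEL, of FINITE ORDER, unitary, trivial on the higher unit group `U_w^{(e+1)} = 1 + 2𝔭_w = {x : v_w(x − 1) < v_w(2)}`
(`e = ord_w 2`; at `w ∤ 2` these are the principal units), and with `θ_w(−1) ≠ 1` (`−1 ∉ 1 + 2𝔭_w` as `v_w(−1 − 1) = v_w(2)`).  It is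
`φ ∘ (𝒪_wˣ → 𝒪_wˣ / U_w^{(e+1)}) ∘ (unit part)` for a character `φ` of the FINITE abelian group `𝒪_wˣ / U_w^{(e+1)}` (`𝒪_w` compact,
`U^{(e+1)}` an open subgroup; `≅ (𝒪_w/𝔭_w^{e+1})ˣ`) not killing the class of `−1` (characters of a finite abelian group separate points).
[cite: NeukirchANT1999, Ch. II §3 Prop. (3.10) and Ch. II §5 Prop. (5.3)] -/
theorem exists_level_character :
    ∃ θ : (w.adicCompletion E)ˣ →* ℂˣ,
      IsOpen (θ.ker : Set (w.adicCompletion E)ˣ) ∧ IsOfFinOrder θ ∧ (∀ x, ‖((θ x : ℂˣ) : ℂ)‖ = 1) ∧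
      (∀ x : (w.adicCompletion E)ˣ,
        Valued.v ((x : w.adicCompletion E) - 1) < Valued.v (2 : w.adicCompletion E) → θ x = 1) ∧ θ (-1) ≠ 1 := by
  classical
  obtain ⟨υ, hυ⟩ := exists_unitPart w
  obtain ⟨hv2, hv2le⟩ := valued_two_ne_zero_and_le_one w
  haveI : CompactSpace (w.adicCompletionIntegers E) :=
    Literature.NumberTheory.Automorphic.compactSpace_adicCompletionIntegers' E w
  set e : (w.adicCompletionIntegers E).unitGroup ≃* (w.adicCompletionIntegers E)ˣ :=
    (w.adicCompletionIntegers E).unitGroupMulEquiv with he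
  have hecoe : ∀ a : (w.adicCompletionIntegers E).unitGroup,
      (((e a : (w.adicCompletionIntegers E)ˣ) : w.adicCompletionIntegers E) : w.adicCompletion E) =
        ((a : (w.adicCompletion E)ˣ) : w.adicCompletion E) := fun a => by
    rw [he, ValuationSubring.coe_unitGroupMulEquiv_apply]
  -- valuations of units of `𝒪_w` are `≤ 1`
  have hle : ∀ u : (w.adicCompletionIntegers E)ˣ,
      Valued.v (((u : w.adicCompletionIntegers E)) : w.adicCompletion E) ≤ 1 := fun u =>
    (Valuation.mem_valuationSubring_iff _ _).1 (u : w.adicCompletionIntegers E).2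
  -- the higher unit group `U^{(e+1)} = {u : v(u - 1) < v 2}` of `𝒪_wˣ`
  obtain ⟨H, hHmem⟩ : ∃ H : Subgroup (w.adicCompletionIntegers E)ˣ, ∀ u : (w.adicCompletionIntegers E)ˣ, u ∈ H ↔
      Valued.v ((((u : w.adicCompletionIntegers E)) : w.adicCompletion E) - 1) < Valued.v (2 : w.adicCompletion E) :=
    ⟨{ carrier := {u | Valued.v ((((u : w.adicCompletionIntegers E)) : w.adicCompletion E) - 1) <
          Valued.v (2 : w.adicCompletion E)}
       mul_mem' := fun {a b} ha hb => by
         simp only [Set.mem_setOf_eq] at ha hb ⊢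
         rw [Units.val_mul, MulMemClass.coe_mul]
         have hsplit : (((a : w.adicCompletionIntegers E)) : w.adicCompletion E) *
               (((b : w.adicCompletionIntegers E)) : w.adicCompletion E) - 1 =
             (((a : w.adicCompletionIntegers E)) : w.adicCompletion E) *
               ((((b : w.adicCompletionIntegers E)) : w.adicCompletion E) - 1) +
               ((((a : w.adicCompletionIntegers E)) : w.adicCompletion E) - 1) := by ring
         rw [hsplit]
         refine (Valuation.map_add _ _ _).trans_lt (max_lt ?_ ha)
         rw [Valuation.map_mul]
         exact mul_lt_of_le_one_of_lt (hle a) hb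
       one_mem' := by
         simp only [Set.mem_setOf_eq, Units.val_one, OneMemClass.coe_one, sub_self, Valuation.map_zero]
         exact zero_lt_iff.2 hv2
       inv_mem' := fun {a} ha => by
         simp only [Set.mem_setOf_eq] at ha ⊢
         have hinv : (((a⁻¹ : (w.adicCompletionIntegers E)ˣ) : w.adicCompletionIntegers E) : w.adicCompletion E) *
             (((a : w.adicCompletionIntegers E)) : w.adicCompletion E) = 1 := by
           rw [← MulMemClass.coe_mul, ← Units.val_mul, inv_mul_cancel, Units.val_one, OneMemClass.coe_one]
         have hrw : (((a⁻¹ : (w.adicCompletionIntegers E)ˣ) : w.adicCompletionIntegers E) : w.adicCompletion E) - 1 =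
             (((a⁻¹ : (w.adicCompletionIntegers E)ˣ) : w.adicCompletionIntegers E) : w.adicCompletion E) *
               (1 - (((a : w.adicCompletionIntegers E)) : w.adicCompletion E)) := by
           rw [mul_sub, mul_one, hinv]
         rw [hrw, Valuation.map_mul, Valuation.map_sub_swap]
         exact mul_lt_of_le_one_of_lt (hle a⁻¹) ha }, fun u => Iff.rfl⟩
  have hHopen : IsOpen (H : Set (w.adicCompletionIntegers E)ˣ) := by
    have h := (isOpen_setOf_valued_sub_one_lt_two w).preimage
      (show Continuous fun u : (w.adicCompletionIntegers E)ˣ => (((u : w.adicCompletionIntegers E)) : w.adicCompletion E) from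
        continuous_subtype_val.comp Units.continuous_val)
    convert h using 1
    ext u
    rw [SetLike.mem_coe, hHmem, Set.mem_preimage, Set.mem_setOf_eq]
  haveI : Finite ((w.adicCompletionIntegers E)ˣ ⧸ H) := Subgroup.quotient_finite_of_isOpen H hHopen
  -- `-1 ∉ H`
  have hm1 : (-1 : (w.adicCompletionIntegers E)ˣ) ∉ H := by
    rw [hHmem, Units.val_neg, Units.val_one, NegMemClass.coe_neg, OneMemClass.coe_one,
      show (-1 : w.adicCompletion E) - 1 = -2 by norm_num, Valuation.map_neg]
    exact lt_irrefl _
  have hmk : (QuotientGroup.mk (-1) : (w.adicCompletionIntegers E)ˣ ⧸ H) ≠ 1 := by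
    rw [Ne, QuotientGroup.eq_one_iff]
    exact hm1
  -- characters of a finite abelian group separate points (stated over an abstract finite group: the instance
  -- `NeZero (Monoid.exponent _)` is not found by unification on the quotient of the units of `𝒪_w` directly)
  have key : ∀ (G : Type) [CommGroup G] [Finite G] (a : G), a ≠ 1 →
      ∃ φ : G →* ℂˣ, φ a ≠ 1 ∧ ∃ n : ℕ, 0 < n ∧ ∀ g, φ g ^ n = 1 := fun G _ _ a ha => by
    obtain ⟨φ, hφ⟩ := CommGroup.exists_apply_ne_one_of_hasEnoughRootsOfUnity G ℂ ha
    exact ⟨φ, hφ, Nat.card G, Nat.card_pos, fun g => by rw [← map_pow, pow_card_eq_one', map_one]⟩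
  obtain ⟨φ, hφ, n, hn0, hφpow⟩ := key _ _ hmk
  have hφnorm : ∀ g, ‖((φ g : ℂˣ) : ℂ)‖ = 1 := fun g => by
    have h1 : ‖((φ g : ℂˣ) : ℂ)‖ ^ n = 1 := by
      rw [← norm_pow, ← Units.val_pow_eq_pow_val, hφpow, Units.val_one, norm_one]
    exact (pow_eq_one_iff_of_nonneg (norm_nonneg _) hn0.ne').1 h1
  let θ : (w.adicCompletion E)ˣ →* ℂˣ := φ.comp ((QuotientGroup.mk' H).comp (e.toMonoidHom.comp υ))
  have hθ : ∀ x, θ x = φ (QuotientGroup.mk (e (υ x))) := fun x => rfl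
  -- the character is trivial on `U^{(e+1)}`
  have hlevel : ∀ x : (w.adicCompletion E)ˣ,
      Valued.v ((x : w.adicCompletion E) - 1) < Valued.v (2 : w.adicCompletion E) → θ x = 1 := by
    intro x hx
    have hvx : Valued.v (x : w.adicCompletion E) = 1 := by
      have := Valuation.map_one_add_of_lt Valued.v (hx.trans_le hv2le)
      rwa [add_sub_cancel] at this
    have hmem : e (υ x) ∈ H := by
      rw [hHmem, hecoe, hυ x hvx]
      exact hx
    rw [hθ, (QuotientGroup.eq_one_iff _).2 hmem, map_one]
  refine ⟨θ, ?_, ?_, fun x => by rw [hθ]; exact hφnorm _, hlevel, ?_⟩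
  · -- open kernel
    refine Subgroup.isOpen_of_mem_nhds _ (g := 1) ?_
    have hU : {y : w.adicCompletion E | Valued.v (y - 1) < Valued.v (2 : w.adicCompletion E)} ∈
        nhds (1 : w.adicCompletion E) :=
      (isOpen_setOf_valued_sub_one_lt_two w).mem_nhds (by
        rw [Set.mem_setOf_eq, sub_self, Valuation.map_zero]; exact zero_lt_iff.2 hv2)
    have hU' : (Units.val ⁻¹' {y : w.adicCompletion E | Valued.v (y - 1) < Valued.v (2 : w.adicCompletion E)}) ∈
        nhds (1 : (w.adicCompletion E)ˣ) :=
      Units.continuous_val.continuousAt.preimage_mem_nhds (by rw [Units.val_one]; exact hU)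
    exact Filter.mem_of_superset hU' fun x hx => hlevel x hx
  · -- finite order
    refine isOfFinOrder_iff_pow_eq_one.2 ⟨n, hn0, MonoidHom.ext fun x => ?_⟩
    rw [MonoidHom.pow_apply, MonoidHom.one_apply, hθ, hφpow]
  · -- θ(-1) ≠ 1
    have hv1 : Valued.v (((-1 : (w.adicCompletion E)ˣ)) : w.adicCompletion E) = 1 := by
      rw [Units.val_neg, Units.val_one, Valuation.map_neg, Valuation.map_one]
    have hmem : (-1 : (w.adicCompletion E)ˣ) ∈ (w.adicCompletionIntegers E).unitGroup :=
      (Valuation.mem_unitGroup_iff _ Valued.v _).2 hv1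
    have hυ1 : υ (-1) = ⟨-1, hmem⟩ := Subtype.ext (hυ _ hv1)
    have he1 : e (υ (-1)) = -1 := by
      rw [hυ1]
      apply Units.ext
      apply Subtype.ext
      rw [hecoe]
      conv_rhs => rw [Units.val_neg, Units.val_one, NegMemClass.coe_neg, OneMemClass.coe_one]
      rfl
    rw [hθ, he1]
    exact hφ

/-- A homomorphism with open kernel is locally constant (copy of the tree's private lemma). [folklore] -/
private theorem isLocallyConstant_of_isOpen_ker {Γ G : Type*} [Group Γ] [TopologicalSpace Γ]
    [ContinuousMul Γ] [Group G] (r : Γ →* G) (h : IsOpen (r.ker : Set Γ)) :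
    IsLocallyConstant r := by
  refine (IsLocallyConstant.iff_exists_open r).2 fun σ => ⟨{τ | σ⁻¹ * τ ∈ r.ker}, ?_, ?_, ?_⟩
  · exact h.preimage (continuous_const_mul σ⁻¹)
  · show σ⁻¹ * σ ∈ r.ker
    rw [inv_mul_cancel]; exact r.ker.one_mem
  · intro τ hτ
    have hτ' : r (σ⁻¹ * τ) = 1 := hτ
    rw [map_mul, map_inv, inv_mul_eq_one] at hτ'
    exact hτ'.symm

/-- a character of `E_wˣ` with open kernel is continuous (as a `ℂ`-valued function). [folklore] -/
private theorem continuous_of_isOpen_ker (θ : (w.adicCompletion E)ˣ →* ℂˣ) (h : IsOpen (θ.ker : Set (w.adicCompletion E)ˣ)) :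
    Continuous fun x => ((θ x : ℂˣ) : ℂ) :=
  Units.continuous_val.comp (isLocallyConstant_of_isOpen_ker θ h).continuous

/-- a value `z` of a homomorphism at an involution (`z² = 1`) with `z ≠ 1` is `−1` (in `ℂˣ`). [folklore] -/
private theorem eq_neg_one_of_sq {θ : (w.adicCompletion E)ˣ →* ℂˣ} (hθneg : θ (-1) ≠ 1) : θ (-1) = -1 := by
  have h1 : θ (-1) ^ 2 = 1 := by rw [← map_pow, neg_one_sq, map_one]
  have h2' : (((θ (-1) : ℂˣ) : ℂ)) ^ 2 = 1 := by rw [← Units.val_pow_eq_pow_val, h1, Units.val_one]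
  rcases sq_eq_one_iff.1 h2' with h | h
  · exact absurd (Units.ext h) hθneg
  · exact Units.ext (by rw [h, Units.val_neg, Units.val_one])

end Local

/-! ## §2 The place model of a quadratic extension `E/F`: the level twist `χ = θ_w((x / (c ⊗ 1) x)_w)` at EVERY place -/

section PlaceModel

open UnitaryGroup

variable {F : Type} (E : Type) [Field F] [NumberField F] [Field E] [NumberField E] [Algebra F E]
  [Algebra.IsQuadraticExtension F E] (v : HeightOneSpectrum (𝓞 F)) (c : E ≃ₐ[F] E)
  {δ : E} (hcδ : c δ = -δ) (hδ : δ ≠ 0)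

omit [Algebra.IsQuadraticExtension F E] in
include hcδ in
/-- **the level twisting character of the place model, at EVERY place `w ∣ v`** (the places above `2` included): a character
`χ : E_vˣ → ℂˣ` — `θ_w` (§1) of the `w`-component of `x · ((c ⊗ 1) x)⁻¹` — which is unitary, continuous, of finite order, TRIVIAL on
every `(c ⊗ 1)`-fixed unit (in particular on `ι_v(F_vˣ)`, `conjLocal_toLocalRing`), and takes the value `θ_w(−1) = −1` at Step 1's
representative `ε = δ ⊗ 1` (`(c ⊗ 1) ε = −ε`, so `ε · ((c ⊗ 1) ε)⁻¹ = −1`).  Same construction as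
`LemD1IndexedNonVacuityTameTwist.exists_twistChar`, with the level character in place of the tame one — no hypothesis on `w`.
[cite: Liu2021, App. D §D.1 Steps 1–2 (l. 5217–5219)] [cite: NeukirchANT1999, Ch. II §3 Prop. (3.10)] -/
theorem exists_twistChar (w : PlacesOver E v) :
    ∃ χ : (LocalRing E v)ˣ →* ℂˣ,
      (∀ x, ‖((χ x : ℂˣ) : ℂ)‖ = 1) ∧ (Continuous fun x => ((χ x : ℂˣ) : ℂ)) ∧ IsOfFinOrder χ ∧
      (∀ x : (LocalRing E v)ˣ, conjLocal E c v x = x → χ x = 1) ∧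
      (∀ a : (v.adicCompletion F)ˣ, χ (Units.map (algebraMap (v.adicCompletion F) (LocalRing E v)).toMonoidHom a) = 1) ∧
      χ (LemD1OfPlace.eps E v hδ) = -1 := by
  obtain ⟨θ, hθopen, hθfin, hθnorm, -, hθneg⟩ := exists_level_character w.1
  -- `ρ x = x · ((c ⊗ 1) x)⁻¹`, `pr_w`, and `χ = θ ∘ pr_w ∘ ρ`
  let cu : (LocalRing E v)ˣ →* (LocalRing E v)ˣ := Units.map (conjLocal E c v).toMonoidHom
  let ρ : (LocalRing E v)ˣ →* (LocalRing E v)ˣ := (MonoidHom.id _) / cu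
  have hρ : ∀ x, ρ x = x * (cu x)⁻¹ := fun x => by
    rw [MonoidHom.div_apply, MonoidHom.id_apply, div_eq_mul_inv]
  let prw : (LocalRing E v)ˣ →* (w.1.adicCompletion E)ˣ :=
    Units.map (Pi.evalRingHom (fun w' : PlacesOver E v => w'.1.adicCompletion E) w).toMonoidHom
  have hθsq : θ (-1) = -1 := eq_neg_one_of_sq w.1 hθneg
  refine ⟨θ.comp (prw.comp ρ), fun x => hθnorm _, ?_, ?_, ?_, ?_, ?_⟩
  · -- continuity
    have hρc : Continuous ρ := by
      have : (ρ : (LocalRing E v)ˣ → (LocalRing E v)ˣ) = fun x => x * (cu x)⁻¹ := funext hρ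
      rw [this]
      exact continuous_id.mul ((Continuous.units_map _ (continuous_conjLocal E c v)).inv)
    exact (continuous_of_isOpen_ker w.1 θ hθopen).comp ((Continuous.units_map _ (continuous_apply w)).comp hρc)
  · -- finite order
    obtain ⟨n, hn, hθn⟩ := hθfin.exists_pow_eq_one
    refine isOfFinOrder_iff_pow_eq_one.2 ⟨n, hn, MonoidHom.ext fun x => ?_⟩
    rw [MonoidHom.pow_apply, MonoidHom.one_apply, MonoidHom.comp_apply, ← MonoidHom.pow_apply, hθn, MonoidHom.one_apply]
  · -- trivial on `(c ⊗ 1)`-fixed units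
    intro x hx
    have hcu : cu x = x := Units.ext hx
    rw [MonoidHom.comp_apply, MonoidHom.comp_apply, hρ, hcu, mul_inv_cancel, map_one, map_one]
  · -- trivial on `ι_v(F_vˣ)`
    intro a
    have hcu : cu (Units.map (algebraMap (v.adicCompletion F) (LocalRing E v)).toMonoidHom a) =
        Units.map (algebraMap (v.adicCompletion F) (LocalRing E v)).toMonoidHom a :=
      Units.ext (by
        change conjLocal E c v (algebraMap (v.adicCompletion F) (LocalRing E v) a) = algebraMap (v.adicCompletion F) (LocalRing E v) a
        rw [algebraMap_localRing_eq, conjLocal_toLocalRing])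
    rw [MonoidHom.comp_apply, MonoidHom.comp_apply, hρ, hcu, mul_inv_cancel, map_one, map_one]
  · -- value at `ε = δ ⊗ 1`
    have hcu : cu (LemD1OfPlace.eps E v hδ) = -LemD1OfPlace.eps E v hδ :=
      Units.ext (by
        change conjLocal E c v (algebraMap E (LocalRing E v) δ) = -algebraMap E (LocalRing E v) δ
        rw [conjLocal_algebraMap, hcδ, map_neg])
    have hρe : ρ (LemD1OfPlace.eps E v hδ) = -1 := by
      rw [hρ, hcu, inv_neg, mul_neg, mul_inv_cancel]
    have hpr : prw (-1) = -1 := Units.ext rfl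
    rw [MonoidHom.comp_apply, MonoidHom.comp_apply, hρe, hpr, hθsq]

/-! ## §3 The twist: a SECOND Step-2 datum `μ · χ` next to any Step-2 datum `μ`, at EVERY place -/

omit [Algebra.IsQuadraticExtension F E] in
include hcδ in
/-- **a SECOND Step-2 datum at EVERY place** (split, inert or ramified; above `2` or not): for every Step-2 datum `μ` of the place model
(displayed binder shape: unitary, continuous, the printed clause «`μ(ι_v a) = 1 ↔ a ∈ Nm E_vˣ`», [App. D §D.1 Step 2]) there is a Step-2
datum `μ'` with `μ'(ε) = −μ(ε)` at `ε = δ ⊗ 1` — so `μ' ≠ μ` —, agreeing with `μ` on the `(c ⊗ 1)`-fixed units, and `μ' = μ · χ` for a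
character `χ` of finite order (the level twist of §2; the printed clause only sees `ι_v(F_vˣ)`, where `χ = 1`:
`LemD1IndexedNonVacuityTameTwist.stepTwo_clause_mul`).  The tree had this at the places `∤ 2` (`…TameTwist.exists_stepTwo_twist`).
[cite: Liu2021, App. D §D.1 Step 2 (l. 5219)] [cite: NeukirchANT1999, Ch. II §3 Prop. (3.10)] -/
theorem exists_stepTwo_twist (w : PlacesOver E v)
    (μ : (LocalRing E v)ˣ →* ℂˣ) (hμn : ∀ x, ‖((μ x : ℂˣ) : ℂ)‖ = 1) (hμc : Continuous fun x => ((μ x : ℂˣ) : ℂ))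
    (hμF : ∀ a : (v.adicCompletion F)ˣ,
      μ (Units.map (algebraMap (v.adicCompletion F) (LocalRing E v)).toMonoidHom a) = 1 ↔
        ∃ x : (LocalRing E v)ˣ, (x : LocalRing E v) * conjLocal E c v x =
          algebraMap (v.adicCompletion F) (LocalRing E v) a) :
    ∃ (μ' : (LocalRing E v)ˣ →* ℂˣ) (_ : ∀ x, ‖((μ' x : ℂˣ) : ℂ)‖ = 1) (_ : Continuous fun x => ((μ' x : ℂˣ) : ℂ))
      (_ : ∀ a : (v.adicCompletion F)ˣ,
        μ' (Units.map (algebraMap (v.adicCompletion F) (LocalRing E v)).toMonoidHom a) = 1 ↔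
          ∃ x : (LocalRing E v)ˣ, (x : LocalRing E v) * conjLocal E c v x =
            algebraMap (v.adicCompletion F) (LocalRing E v) a),
      μ' (LemD1OfPlace.eps E v hδ) = -μ (LemD1OfPlace.eps E v hδ) ∧ μ' ≠ μ ∧
      (∀ x : (LocalRing E v)ˣ, conjLocal E c v x = x → μ' x = μ x) ∧
      ∃ χ : (LocalRing E v)ˣ →* ℂˣ, IsOfFinOrder χ ∧ μ' = μ * χ := by
  obtain ⟨χ, hχn, hχc, hχfin, hχfix, hχF, hχe⟩ := exists_twistChar E v c hcδ hδ w
  refine ⟨μ * χ, fun x => ?_, ?_, LemD1IndexedNonVacuityTameTwist.stepTwo_clause_mul E v c μ χ hμF hχF, ?_, ?_,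
    fun x hx => ?_, χ, hχfin, rfl⟩
  · rw [MonoidHom.mul_apply, Units.val_mul, norm_mul, hμn, hχn, mul_one]
  · have : (fun x => (((μ * χ) x : ℂˣ) : ℂ)) = fun x => ((μ x : ℂˣ) : ℂ) * ((χ x : ℂˣ) : ℂ) :=
      funext fun x => by rw [MonoidHom.mul_apply, Units.val_mul]
    rw [this]
    exact hμc.mul hχc
  · rw [MonoidHom.mul_apply, hχe, mul_neg, mul_one]
  · intro h
    have h1 := DFunLike.congr_fun h (LemD1OfPlace.eps E v hδ)
    rw [MonoidHom.mul_apply, hχe, mul_neg, mul_one] at h1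
    have h2' := Units.ext_iff.1 h1
    rw [Units.val_neg] at h2'
    have h3 : (((μ (LemD1OfPlace.eps E v hδ)) : ℂˣ) : ℂ) = 0 := by linear_combination (-1 : ℂ) / 2 * h2'
    exact (μ (LemD1OfPlace.eps E v hδ)).ne_zero h3
  · rw [MonoidHom.mul_apply, hχfix x hx, mul_one]

variable (N : ℕ) (J : Matrix (Fin N) (Fin N) E) (hN : 2 ≤ N) (hJh : (J.map c)ᵀ = J) (hJdet : J.det ≠ 0)

include hcδ in
/-- **`MuSet` form, EVERY place**: next to every element `μ` of the printed Step-2 index set `LemD1.MuSet (LemD1OfPlace.standingData …)`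
of the place model there is a DIFFERENT element `μ'`, `μ'(ε) = −μ(ε)`, agreeing with `μ` on the `(c ⊗ 1)`-fixed units — at every place
`w ∣ v` whatsoever. [cite: Liu2021, App. D §D.1 Step 2 (l. 5219)] -/
theorem exists_muSet_ne_twist (w : PlacesOver E v)
    (μ : LemD1.MuSet (LemD1OfPlace.standingData E v c N J hcδ hδ hN hJh hJdet)) :
    ∃ μ' : LemD1.MuSet (LemD1OfPlace.standingData E v c N J hcδ hδ hN hJh hJdet),
      μ' ≠ μ ∧ μ'.1 (LemD1OfPlace.eps E v hδ) = -μ.1 (LemD1OfPlace.eps E v hδ) ∧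
      ∀ x : (LocalRing E v)ˣ, conjLocal E c v x = x → μ'.1 x = μ.1 x := by
  obtain ⟨μ', hμ'n, hμ'c, hμ'F, he, hne, hfix, -⟩ := exists_stepTwo_twist E v c hcδ hδ w μ.1 μ.2.1 μ.2.2.1 μ.2.2.2
  exact ⟨LemD1OfPlace.muOf E v c N J hcδ hδ hN hJh hJdet μ' hμ'n hμ'c hμ'F, fun h => hne (congrArg Subtype.val h), he, hfix⟩

include hcδ in
/-- **… packaged through `LemD1OfPlace.muOf`** (the rows' own packaging, with the displayed proof shapes): `muOf μ' ≠ muOf μ`,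
`μ'(ε) = −μ(ε)` — EVERY place. [cite: Liu2021, App. D §D.1 Step 2 (l. 5219)] -/
theorem exists_muOf_ne_twist (w : PlacesOver E v)
    (μ : (LocalRing E v)ˣ →* ℂˣ) (hμn : ∀ x, ‖((μ x : ℂˣ) : ℂ)‖ = 1) (hμc : Continuous fun x => ((μ x : ℂˣ) : ℂ))
    (hμF : ∀ a : (v.adicCompletion F)ˣ,
      μ (Units.map (algebraMap (v.adicCompletion F) (LocalRing E v)).toMonoidHom a) = 1 ↔
        ∃ x : (LocalRing E v)ˣ, (x : LocalRing E v) * conjLocal E c v x =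
          algebraMap (v.adicCompletion F) (LocalRing E v) a) :
    ∃ (μ' : (LocalRing E v)ˣ →* ℂˣ) (hμ'n : ∀ x, ‖((μ' x : ℂˣ) : ℂ)‖ = 1) (hμ'c : Continuous fun x => ((μ' x : ℂˣ) : ℂ))
      (hμ'F : ∀ a : (v.adicCompletion F)ˣ,
        μ' (Units.map (algebraMap (v.adicCompletion F) (LocalRing E v)).toMonoidHom a) = 1 ↔
          ∃ x : (LocalRing E v)ˣ, (x : LocalRing E v) * conjLocal E c v x =
            algebraMap (v.adicCompletion F) (LocalRing E v) a),
      μ' (LemD1OfPlace.eps E v hδ) = -μ (LemD1OfPlace.eps E v hδ) ∧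
      LemD1OfPlace.muOf E v c N J hcδ hδ hN hJh hJdet μ' hμ'n hμ'c hμ'F ≠
        LemD1OfPlace.muOf E v c N J hcδ hδ hN hJh hJdet μ hμn hμc hμF := by
  obtain ⟨μ', hμ'n, hμ'c, hμ'F, he, hne, -, -⟩ := exists_stepTwo_twist E v c hcδ hδ w μ hμn hμc hμF
  exact ⟨μ', hμ'n, hμ'c, hμ'F, he, fun h => hne (congrArg Subtype.val h)⟩

include hcδ in
/-- **two Step-2 data whenever there is one, EVERY place**: the printed Step-2 index set of the place model is either empty or has
at least two elements — at no finite place is a Step-2 datum unique. [cite: Liu2021, App. D §D.1 Step 2 (l. 5219)] -/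
theorem exists_muSet_ne_of_nonempty
    (hμ : Nonempty (LemD1.MuSet (LemD1OfPlace.standingData E v c N J hcδ hδ hN hJh hJdet))) :
    ∃ μ₁ μ₂ : LemD1.MuSet (LemD1OfPlace.standingData E v c N J hcδ hδ hN hJh hJdet), μ₁ ≠ μ₂ := by
  obtain ⟨w⟩ := (inferInstance : Nonempty (PlacesOver E v))
  obtain ⟨μ⟩ := hμ
  obtain ⟨μ', hne, -⟩ := exists_muSet_ne_twist E v c hcδ hδ N J hN hJh hJdet w μ
  exact ⟨μ', μ, hne⟩

/-! ## §4 The μ-teeth of [Lem. D.1 (3)] AS PRINTED bite at EVERY place carrying a Step-2 datum -/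

/-- **Item (1) AS PRINTED holds at a character datum of rank `n ≠ 2`** (both sides of (1) false; the maximal `χ`-quotient is the line).
Private twin of the siblings' lemma. [cite: Liu2021, App. D Lemma D.1 (1) (l. 5229)] -/
private theorem lemD1_1AsPrinted_of_character_of_rank_ne_two' {F₀ E₀ : Type} [Field F₀] [ValuativeRel F₀]
    [TopologicalSpace F₀] [CommRing E₀] [Algebra F₀ E₀] [TopologicalSpace E₀] [IsTopologicalRing E₀] {n₀ : ℕ}
    (L : LemD1Data F₀ E₀ n₀ ℂ) (lam : L.S.U →* ℂˣ) (hω : ∀ (g : L.S.U) (x : ℂ), L.omega g x = (lam g : ℂ) * x)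
    (hcen : ∀ z : L.S.normOne, lam (L.S.scalar z) = L.chi z)
    (hopen : ∃ O : Set L.S.U, IsOpen O ∧ (1 : L.S.U) ∈ O ∧ ∀ g ∈ O, lam g = 1) (hn : n₀ ≠ 2) :
    LemD1_1AsPrinted L := by
  have hN : augmentation L.omega L.S.scalar L.chi = ⊥ := by
    unfold augmentation
    refine iSup_eq_bot.2 fun z => ?_
    rw [LinearMap.range_eq_bot]
    ext
    simp [hω, hcen]
  have hfin : Module.finrank ℂ (ℂ ⧸ augmentation L.omega L.S.scalar L.chi) = 1 := by
    rw [(Submodule.quotEquivOfEqBot _ hN).finrank_eq, Module.finrank_self]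
  haveI hsimple : IsSimpleModule ℂ (ℂ ⧸ augmentation L.omega L.S.scalar L.chi) :=
    isSimpleModule_iff_finrank_eq_one.2 hfin
  have hact : ∀ (g : L.S.U) (w : ℂ ⧸ augmentation L.omega L.S.scalar L.chi),
      L.datum.quot g w = (lam g : ℂ) • w := by
    intro g w
    obtain ⟨y, rfl⟩ := Submodule.Quotient.mk_surjective _ w
    rw [LemD1Data.datum_quot, quotRep_mk, hω, ← smul_eq_mul, Submodule.Quotient.mk_smul]
  refine ⟨⟨?_, ?_, ?_⟩, ?_⟩
  · intro W
    rcases eq_bot_or_eq_top W.toSubmodule with h | h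
    · exact Or.inl (Subrepresentation.toSubmodule_injective h)
    · exact Or.inr (Subrepresentation.toSubmodule_injective h)
  · intro x
    obtain ⟨O, hO, h1O, hlam⟩ := hopen
    change IsOpen (L.datum.quot.stabilizerSubgroup x : Set L.S.U)
    refine Subgroup.isOpen_of_mem_nhds _ (g := 1) (Filter.mem_of_superset (hO.mem_nhds h1O) fun g hg => ?_)
    change L.datum.quot g x = x
    rw [hact, hlam g hg, Units.val_one, one_smul]
  · intro K _
    infer_instance
  · refine iff_of_false ?_ ?_
    · rw [not_subsingleton_iff_nontrivial]
      exact Module.nontrivial_of_finrank_pos (R := ℂ) (by rw [hfin]; exact one_pos)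
    · exact fun h => hn h.2.1.2

include hcδ in
/-- **the μ-teeth of [Lem. D.1 (3)] AS PRINTED at EVERY place carrying a Step-2 datum** (rank `N ≥ 3`; the places above `2` included):
for every element `μ` of the printed Step-2 index set of the place model and every representative `e`, the two-member collection with
labels `(μ, e, 1)`, `(μ', e, 1)` — `μ'` the level twist of §3, `μ'(ε) = −μ(ε)` — and BOTH carriers the trivial line satisfies (1) member by
member (rank `≠ 2`) but VIOLATES `LemD1_3AsPrintedI`: its two `ω`'s are isomorphic (equal) while `μ ≠ μ'`.
[cite: Liu2021, App. D Lemma D.1 (1) and (3) (l. 5229, 5233)] -/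
theorem exists_lemD1IndexedFamily_item1_not_lemD1_3_twist (w : PlacesOver E v) (h3 : 3 ≤ N)
    (μ : LemD1.MuSet (LemD1OfPlace.standingData E v c N J hcδ hδ hN hJh hJdet))
    (e : LemD1.EpsRep (LemD1OfPlace.standingData E v c N J hcδ hδ hN hJh hJdet)) :
    ∃ Lf : LemD1IndexedFamily (v.adicCompletion F) (LocalRing E v) N (Fin 2),
      Lf.S = LemD1OfPlace.standingData E v c N J hcδ hδ hN hJh hJdet ∧
      (∀ i, (Lf.eps i).1 = e.1) ∧ (∀ i, (Lf.chi i).1 = 1) ∧ (Lf.mu 0).1 = μ.1 ∧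
      (Lf.mu 1).1 (LemD1OfPlace.eps E v hδ) = -μ.1 (LemD1OfPlace.eps E v hδ) ∧
      Lf.Item1AsPrinted ∧ Lf.mu 0 ≠ Lf.mu 1 ∧ ¬ LemD1_3AsPrintedI Lf := by
  classical
  obtain ⟨e₁, he₁⟩ := e
  have hN2 : N ≠ 2 := by omega
  obtain ⟨μ₁, hne, hμ₁, -⟩ := exists_muSet_ne_twist E v c hcδ hδ N J hN hJh hJdet w μ
  let χ : LemD1.ChiSet (LemD1OfPlace.standingData E v c N J hcδ hδ hN hJh hJdet) :=
    ⟨1, fun z => by simp, by simpa using continuous_const⟩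
  let ω₀ : Representation ℂ (LemD1OfPlace.standingData E v c N J hcδ hδ hN hJh hJdet).U ℂ :=
    Representation.trivial ℂ _ ℂ
  have hω₀ : ∀ (g : (LemD1OfPlace.standingData E v c N J hcδ hδ hN hJh hJdet).U) (x : ℂ),
      ω₀ g x = ((1 : (LemD1OfPlace.standingData E v c N J hcδ hδ hN hJh hJdet).U →* ℂˣ) g : ℂ) * x := fun g x => by
    rw [MonoidHom.one_apply, Units.val_one, one_mul]; rfl
  let Lf : LemD1IndexedFamily (v.adicCompletion F) (LocalRing E v) N (Fin 2) :=
    { isNonarchimedeanLocalField := inferInstance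
      isModuleTopology := LemD1OfPlace.isModuleTopology_localRing E v
      S := LemD1OfPlace.standingData E v c N J hcδ hδ hN hJh hJdet
      mu := ![μ, μ₁]
      eps := fun _ => ⟨e₁, he₁⟩
      chi := fun _ => χ
      V := fun _ => ℂ
      omega := fun _ => ω₀ }
  have hμne : Lf.mu 0 ≠ Lf.mu 1 := fun h => hne h.symm
  have hItem1 : Lf.Item1AsPrinted := fun i =>
    lemD1_1AsPrinted_of_character_of_rank_ne_two' (Lf.single i) 1 hω₀ (fun z => rfl)
      ⟨Set.univ, isOpen_univ, Set.mem_univ _, fun g _ => rfl⟩ hN2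
  have hnot3 : ¬ LemD1_3AsPrintedI Lf := fun h =>
    hμne ((h h3 0 1).1 ⟨LinearEquiv.refl ℂ _, fun _ _ => rfl⟩).1.symm
  exact ⟨Lf, rfl, fun _ => rfl, fun _ => rfl, rfl, hμ₁, hItem1, hμne, hnot3⟩

include hcδ in
/-- **at EVERY place carrying a Step-2 datum, (3) AS PRINTED is not a consequence of (1)** on two-member collections over the place model
(rank `N ≥ 3`): the displayed record `LemD1_3AsPrintedI` REJECTS carriers that do not separate the two Step-2 labels `μ ≠ μ'` — with no
exception for the places above `2` (`…TameTwist.not_forall_lemD1_3_of_item1_twist` needed `w ∤ 2`).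
[cite: Liu2021, App. D Lemma D.1 (1) and (3) (l. 5229, 5233)] -/
theorem not_forall_lemD1_3_of_item1_twist (h3 : 3 ≤ N)
    (hμ : Nonempty (LemD1.MuSet (LemD1OfPlace.standingData E v c N J hcδ hδ hN hJh hJdet))) :
    ¬ ∀ Lf : LemD1IndexedFamily (v.adicCompletion F) (LocalRing E v) N (Fin 2),
        Lf.S = LemD1OfPlace.standingData E v c N J hcδ hδ hN hJh hJdet → Lf.Item1AsPrinted → LemD1_3AsPrintedI Lf := by
  obtain ⟨w⟩ := (inferInstance : Nonempty (PlacesOver E v))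
  obtain ⟨μ⟩ := hμ
  obtain ⟨Lf, hS, -, -, -, -, h1, -, h3'⟩ := exists_lemD1IndexedFamily_item1_not_lemD1_3_twist E v c hcδ hδ N J hN hJh hJdet
    w h3 μ (LemD1OfPlace.epsDelta E v c N J hcδ hδ hN hJh hJdet)
  exact fun h => h3' (h Lf hS h1)

end PlaceModel

/-! ## §5 The CM rows: the rows' OWN μ-slot `localMu L (toHeckeCharacter L ψ) v` has a companion at EVERY place `v` of `L⁺` -/

section CM

open UnitaryGroup
open Literature.NumberTheory.GelbartRogawski1991.UnitaryDualPair (imagUnit complexConj_imagUnit imagUnit_ne_zero)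
open Literature.NumberTheory.GelbartRogawski1991.UnitaryDualPair.LocalSplitting (localMu localMu_apply norm_localMu
  continuous_localMu localMu_toLocalRing_eq_one_iff)
open Literature.NumberTheory.Automorphic.IdeleClassGroup (toHeckeCharacter isUnitary_toHeckeCharacter IsConjugateSymplectic)
open Literature.RepresentationTheory.Liu2021 (isOscillatorChar_toHeckeCharacter_iff)

variable (L : Type) [Field L] [NumberField L] [IsCMField L]

local notation3 "cc" => (IsCMField.complexConj L)
local notation3 "L⁺" => (↥(maximalRealSubfield L))

variable (v : HeightOneSpectrum (𝓞 (maximalRealSubfield L))) (N : ℕ) (J : Matrix (Fin N) (Fin N) L) (hN : 2 ≤ N)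
  (hJh : (J.map (IsCMField.complexConj L))ᵀ = J) (hJdet : J.det ≠ 0)

/-- **the rows' own μ-slot has a DIFFERENT companion in the printed Step-2 index set at EVERY place `v` of `L⁺`** (split, inert or
ramified, above `2` or not): for every conjugate symplectic `ψ` there is a Step-2 datum `μ'` of the rows' standing data with
`μ'(ε) = −μ_v(ε)` (`μ_v = localMu L (toHeckeCharacter L ψ) v`, `ε = δ ⊗ 1`, `δ = imagUnit L`) and `muOf μ' ≠ muOf μ_v` — the latter
packaged with VERBATIM the rows' displayed proofs. [cite: Liu2021, App. D §D.1 Step 2 (l. 5219); Def. 4.11 (l. 2086)] -/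
theorem exists_muOf_ne_localMu_twist (ψ : IdeleClassGroup L →ₜ* Circle) (hψ : IsConjugateSymplectic L ψ) :
    ∃ (μ' : (LocalRing L v)ˣ →* ℂˣ) (hμ'n : ∀ x, ‖((μ' x : ℂˣ) : ℂ)‖ = 1) (hμ'c : Continuous fun x => ((μ' x : ℂˣ) : ℂ))
      (hμ'F : ∀ a : (v.adicCompletion L⁺)ˣ,
        μ' (Units.map (algebraMap (v.adicCompletion L⁺) (LocalRing L v)).toMonoidHom a) = 1 ↔
          ∃ x : (LocalRing L v)ˣ, (x : LocalRing L v) * conjLocal L cc v x =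
            algebraMap (v.adicCompletion L⁺) (LocalRing L v) a),
      μ' (LemD1OfPlace.eps L v (imagUnit_ne_zero L)) =
        -localMu L (toHeckeCharacter L ψ) v (LemD1OfPlace.eps L v (imagUnit_ne_zero L)) ∧
      LemD1OfPlace.muOf L v cc N J (complexConj_imagUnit L) (imagUnit_ne_zero L) hN hJh hJdet μ' hμ'n hμ'c hμ'F ≠
        LemD1OfPlace.muOf L v cc N J (complexConj_imagUnit L) (imagUnit_ne_zero L) hN hJh hJdet
          (localMu L (toHeckeCharacter L ψ) v)
          (fun x => norm_localMu L (toHeckeCharacter L ψ) v (isUnitary_toHeckeCharacter L ψ) x)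
          (continuous_localMu L (toHeckeCharacter L ψ) v)
          (fun t => localMu_toLocalRing_eq_one_iff L (toHeckeCharacter L ψ) v
            ((isOscillatorChar_toHeckeCharacter_iff ψ).mpr hψ) t) := by
  obtain ⟨w⟩ := (inferInstance : Nonempty (PlacesOver L v))
  exact exists_muOf_ne_twist L v cc (complexConj_imagUnit L) (imagUnit_ne_zero L) N J hN hJh hJdet w _ _ _ _

/-- **the printed Step-2 index set of the rows' standing data has at least TWO elements at EVERY place `v` of `L⁺`** — the cofinite
`LemD1IndexedNonVacuityTameTwist.eventually_exists_muSet_ne` with its exceptional set (the prime factors of `2`) REMOVED.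
[cite: Liu2021, App. D §D.1 Step 2 (l. 5219)] -/
theorem exists_muSet_ne_of_isCMField :
    ∃ μ₁ μ₂ : LemD1.MuSet (LemD1OfPlace.standingData L v cc N J (complexConj_imagUnit L) (imagUnit_ne_zero L) hN hJh hJdet),
      μ₁ ≠ μ₂ :=
  exists_muSet_ne_of_nonempty L v cc (complexConj_imagUnit L) (imagUnit_ne_zero L) N J hN hJh hJdet
    (LemD1IndexedNonVacuityNonsplitPlace.nonempty_muSet_of_isCMField L v N J hN hJh hJdet)

/-- **… at ALL places simultaneously** (the `∀ v` form of the rows' binder). [cite: Liu2021, App. D §D.1 Step 2 (l. 5219)] -/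
theorem forall_exists_muSet_ne_of_isCMField :
    ∀ v : HeightOneSpectrum (𝓞 L⁺),
      ∃ μ₁ μ₂ : LemD1.MuSet (LemD1OfPlace.standingData L v cc N J (complexConj_imagUnit L) (imagUnit_ne_zero L) hN hJh hJdet),
        μ₁ ≠ μ₂ :=
  fun v => exists_muSet_ne_of_isCMField L v N J hN hJh hJdet

/-- **the μ-teeth of [Lem. D.1 (3)] AS PRINTED bite at EVERY place `v` of `L⁺` with the rows' OWN `μ_v` as one label** (rank `N ≥ 3`):
for every conjugate symplectic `ψ` the two-member collection with labels `(μ_v, ε, 1)`, `(μ', ε, 1)` (`μ'` the level companion,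
`μ'(ε) = −μ_v(ε)`) on trivial-line carriers satisfies (1) member by member and VIOLATES `LemD1_3AsPrintedI` — no exceptional place.
[cite: Liu2021, App. D Lemma D.1 (1) and (3) (l. 5229, 5233)] -/
theorem exists_lemD1IndexedFamily_item1_not_lemD1_3_localMu_twist (h3 : 3 ≤ N)
    (ψ : IdeleClassGroup L →ₜ* Circle) (hψ : IsConjugateSymplectic L ψ) :
    ∃ Lf : LemD1IndexedFamily (v.adicCompletion L⁺) (LocalRing L v) N (Fin 2),
      Lf.S = LemD1OfPlace.standingData L v cc N J (complexConj_imagUnit L) (imagUnit_ne_zero L) hN hJh hJdet ∧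
      (∀ i, (Lf.eps i).1 = LemD1OfPlace.eps L v (imagUnit_ne_zero L)) ∧ (∀ i, (Lf.chi i).1 = 1) ∧
      (Lf.mu 0).1 = localMu L (toHeckeCharacter L ψ) v ∧
      (Lf.mu 1).1 (LemD1OfPlace.eps L v (imagUnit_ne_zero L)) =
        -localMu L (toHeckeCharacter L ψ) v (LemD1OfPlace.eps L v (imagUnit_ne_zero L)) ∧
      Lf.Item1AsPrinted ∧ Lf.mu 0 ≠ Lf.mu 1 ∧ ¬ LemD1_3AsPrintedI Lf := by
  obtain ⟨w⟩ := (inferInstance : Nonempty (PlacesOver L v))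
  exact exists_lemD1IndexedFamily_item1_not_lemD1_3_twist L v cc (complexConj_imagUnit L) (imagUnit_ne_zero L) N J hN hJh
    hJdet w h3
    (LemD1OfPlace.muOf L v cc N J (complexConj_imagUnit L) (imagUnit_ne_zero L) hN hJh hJdet
      (localMu L (toHeckeCharacter L ψ) v)
      (fun x => norm_localMu L (toHeckeCharacter L ψ) v (isUnitary_toHeckeCharacter L ψ) x)
      (continuous_localMu L (toHeckeCharacter L ψ) v)
      (fun t => localMu_toLocalRing_eq_one_iff L (toHeckeCharacter L ψ) v
        ((isOscillatorChar_toHeckeCharacter_iff ψ).mpr hψ) t))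
    (LemD1OfPlace.epsDelta L v cc N J (complexConj_imagUnit L) (imagUnit_ne_zero L) hN hJh hJdet)

/-- **the `∀ v` form of the rows' audit statement**: at EVERY finite place `v` of `L⁺` and for every conjugate symplectic `ψ`, the
records `hD1''` ∕ `hD3` read at the rows' slot types (rank `N ≥ 3`) are not satisfied by every collection passing (1) — the μ-conjunct of
(3) is a genuine constraint on the carriers everywhere. [cite: Liu2021, App. D Lemma D.1 (1) and (3) (l. 5229, 5233)] -/
theorem forall_not_forall_lemD1_3_of_item1_of_isCMField (h3 : 3 ≤ N) :
    ∀ v : HeightOneSpectrum (𝓞 L⁺),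
      ¬ ∀ Lf : LemD1IndexedFamily (v.adicCompletion L⁺) (LocalRing L v) N (Fin 2),
          Lf.S = LemD1OfPlace.standingData L v cc N J (complexConj_imagUnit L) (imagUnit_ne_zero L) hN hJh hJdet →
          Lf.Item1AsPrinted → LemD1_3AsPrintedI Lf :=
  fun v => not_forall_lemD1_3_of_item1_twist L v cc (complexConj_imagUnit L) (imagUnit_ne_zero L) N J hN hJh hJdet h3
    (LemD1IndexedNonVacuityNonsplitPlace.nonempty_muSet_of_isCMField L v N J hN hJh hJdet)

end CM

end Literature.NumberTheory.Automorphic.Liu2021.LemD1IndexedNonVacuityLevelTwist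

end
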